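import Literature.NumberTheory.GaloisRepresentations.ContinuousH1OrderTwo
import Literature.NumberTheory.EllipticCurves.H1CorestrictionIndexTwo
import Literature.NumberTheory.EllipticCurves.ArchimedeanLocalCondition
import Literature.NumberTheory.EllipticCurves.PointDivisibilityProofs
import Literature.NumberTheory.EllipticCurves.TorsionCardinality
import Literature.NumberTheory.EllipticCurves.SelmerPInftyGaloisAction
import HarnessLib

/-!
# Route `GenusKolyvaginAtTwo`, LINE 6, KEY crux Q3 `EquivariantKolyvaginExactAtTwo`
# (stmt-BirchSwinnertonDyer-24882): NO ARCHIMEDEAN CONDITION AT `2` WHEN THE DECOMPOSITION GROUP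
# MOVES A `2`-TORSION POINT — `H¹(K_w, E) = 0`, sharp (PROVED)

Helper (seat `bsd-line-gk2-p3` g10, cell `bsd-f1-sign2`; `--supports` the item, closes nothing): the
archimedean input of the eigen/`ℚ` architecture for Q3 (memo Q3-ARCH v2; g9's `…Descent` §5 reading
"no archimedean condition at `2` on `Δ(E) < 0`", here made a theorem about the tree's local
conditions `localRestrictionKer` / `selmerLocalKerPrimary`). When McCallum §5 is run OVER `ℚ` at
`p = 2` (for `E` and its twin `E^K` separately), the real place of `ℚ` enters the Selmer conditions
and the Poitou–Tate sums; the tree so far only knows that the archimedean condition holds UP TO `2`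
(`two_nsmul_mem_selmerLocalKerPrimary_infinitePlace`, `2·H¹(K_w, ·) = 0`). This file proves the SHARP
vanishing under the hypothesis that the decomposition group at `w` MOVES some `2`-torsion point of
`E(K̄_w)` — for `K = ℚ` this says `E(ℝ)[2] ≅ ℤ/2`, i.e. `Δ(E) < 0`, the habitat of Q3 (and then
also `Δ(E^{(c)}) = c⁶ Δ(E) < 0` for every twist):

* §1 (algebra, any group element `c` with `c² = 1` acting on an abelian group `A`): if `A` is
  `2`-divisible and every `c`-fixed element of `A[2]` is a norm `S + cS` with `S ∈ A[2]`, then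
  `cP = −P ⟹ P = cQ − Q` (`exists_eq_smul_sub_of_smul_eq_neg`, "`H¹(C₂, A) = 0`") and
  `cP = P ⟹ P = Q + cQ` (`exists_eq_add_smul_of_smul_eq`, "`Ĥ⁰(C₂, A) = 0`"); and the hypothesis
  holds as soon as `#A[2] = 4` and `c` moves some element of `A[2]`
  (`norm_of_smul_eq_of_card_eq_four`: then `A[2] = {0, T, cT, T + cT} ≅ 𝔽₂[C₂]`).
* §2 (continuous cohomology): `H¹(G, M) = 0` for a group `G` of order `≤ 2` acting on such an `M`
  (`discreteH1_eq_zero_of_natCard_le_two`; crossed homomorphisms, `φ(c) + cφ(c) = φ(c²) = 0`).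
* §3 (elliptic curves): for `W/K` elliptic and a `K`-field `E` of characteristic `0` with
  `#Γ_E ≤ 2` moving a point of `E(K̄_E)[2]`: `H¹(E, E(K̄_E)) = 0` (`localH1_eq_zero`;
  `2`-divisibility `nsmul_surjective_of_isAlgClosed`, `#E[2] = 4` `card_torsionBy_eq_sq`), hence
  `localRestrictionKer W E = ⊤` and `selmerLocalKerPrimary W E p = ⊤` for every `p`.
* §4 (number fields): at an infinite place `w` (`#Γ_{K_w} ≤ 2`,
  `natCard_absoluteGaloisGroup_completion_infinitePlace_le_two`) moving a `2`-torsion point: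
  `localRestrictionKer W K_w = ⊤`, `selmerLocalKerPrimary W K_w p = ⊤`
  (`localRestrictionKer_infinitePlace_eq_top`, `selmerLocalKerPrimary_infinitePlace_eq_top`).

Left for the sequel (real algebra, not cohomology): for `K = ℚ` and `Δ(W) < 0`, complex
conjugation moves a point of `E[2]` (a real cubic with negative discriminant has exactly one real
root), discharging `hmove` on the habitat. Everything here is PROVED from tree theorems (no named
fact, no definition, no `sorry`, standard axioms). BSD is not proved by any of this.

References: [SerreGaloisCohomology1997] I §2.4 (Cor. to Prop. 9; the case `G = Gal(ℂ/ℝ)`);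
[SerreLocalFields1979] VIII §4 (cohomology of finite cyclic groups); [GrossLMS1991] §6, proof of
Prop. 6.2 (1) (the archimedean condition); [MilneADT2006] I Rem. 3.7 (`H¹(ℝ, A)` dual to `π₀(A(ℝ))`);
[SilvermanAEC2009] Cor. III.6.4(b) (`#E[2] = 4`).
-/

set_option autoImplicit false
set_option linter.dupNamespace false -- tree convention: `Summit.BirchSwinnertonDyer.BirchSwinnertonDyer.Theorems` (summit = sub-problem)

noncomputable section

open scoped Classical

namespace Summit.BirchSwinnertonDyer.BirchSwinnertonDyer.Theorems.GenusExact.ArchVanishing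

open Literature.NumberTheory.EllipticCurves Literature.NumberTheory.GaloisRepresentations

universe u

/-! ## §1 Algebra: both Tate cohomology groups of `C₂ = {1, c}` vanish on a `2`-divisible module
whose `c`-fixed `2`-torsion consists of norms -/

section Algebra

variable {G : Type u} [Group G] {A : Type u} [AddCommGroup A] [DistribMulAction G A] {c : G}

/-- **`H¹(C₂, A) = 0`, element form.** Let `c` act on `A` with `c² = 1`; suppose `A` is
`2`-divisible and every `c`-fixed element of `A[2]` is a norm `S + cS` of an element of `A[2]`. Then
every `c`-ANTI-invariant `P` (`cP = −P`) is a `c`-coboundary: `P = cQ − Q`. (Halve `P = 2R`; then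
`U = R + cR ∈ A[2]^c` is a norm `S + cS`, `S ∈ A[2]`, and `Q = −(R + S)` works.) For `A = E(ℂ)`,
`c` = complex conjugation, `Δ(E) < 0`: `H¹(ℝ, E) = 0`.
[cite: SerreLocalFields1979, VIII §4 (cohomology of finite cyclic groups)] -/
theorem exists_eq_smul_sub_of_smul_eq_neg (hcc : c * c = 1) (hdiv : ∀ a : A, ∃ b : A, 2 • b = a)
    (hnorm : ∀ T : A, 2 • T = 0 → c • T = T → ∃ S : A, 2 • S = 0 ∧ T = S + c • S)
    {P : A} (hP : c • P = -P) : ∃ Q : A, P = c • Q - Q := by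
  have key : ∀ x : A, 2 • (c • x) = c • (2 • x) := fun x ↦ by rw [two_nsmul, two_nsmul, smul_add]
  obtain ⟨R, hR⟩ := hdiv P
  have hU2 : 2 • (R + c • R) = 0 := by
    rw [smul_add, key, hR, hP, add_neg_cancel]
  have hUfix : c • (R + c • R) = R + c • R := by
    rw [smul_add, smul_smul, hcc, one_smul, add_comm]
  obtain ⟨S, hS2, hS⟩ := hnorm _ hU2 hUfix
  have h2cS : c • S + c • S = 0 := by
    rw [← two_nsmul, key, hS2, smul_zero]
  refine ⟨-(R + S), ?_⟩
  rw [smul_neg, smul_add, ← hR, two_nsmul]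
  calc R + R = R + R - (c • S + c • S) + ((S + c • S) - (R + c • R)) := by
        rw [h2cS, ← hS, sub_self, sub_zero, add_zero]
    _ = -(c • R + c • S) - -(R + S) := by abel

/-- **`Ĥ⁰(C₂, A) = 0`, element form**: under the same hypotheses every `c`-INVARIANT `P` is a norm,
`P = Q + cQ` (halve `P = 2R`; `U = R − cR ∈ A[2]^c` is a norm `S + cS`; `Q = R + S`). For
`A = E(ℂ)`, `Δ(E) < 0`: the norm `E(ℂ) → E(ℝ)` is onto (`E(ℝ)` is connected).
[cite: SerreLocalFields1979, VIII §4 (cohomology of finite cyclic groups)] -/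
theorem exists_eq_add_smul_of_smul_eq (hcc : c * c = 1) (hdiv : ∀ a : A, ∃ b : A, 2 • b = a)
    (hnorm : ∀ T : A, 2 • T = 0 → c • T = T → ∃ S : A, 2 • S = 0 ∧ T = S + c • S)
    {P : A} (hP : c • P = P) : ∃ Q : A, P = Q + c • Q := by
  have key : ∀ x : A, 2 • (c • x) = c • (2 • x) := fun x ↦ by rw [two_nsmul, two_nsmul, smul_add]
  obtain ⟨R, hR⟩ := hdiv P
  have hU2 : 2 • (R - c • R) = 0 := by
    rw [smul_sub, key, hR, hP, sub_self]
  have hUU : (R - c • R) + (R - c • R) = 0 := by rw [← two_nsmul]; exact hU2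
  have hUfix : c • (R - c • R) = R - c • R := by
    rw [smul_sub, smul_smul, hcc, one_smul, ← sub_eq_zero]
    have e : c • R - R - (R - c • R) = -((R - c • R) + (R - c • R)) := by abel
    rw [e, hUU, neg_zero]
  obtain ⟨S, -, hS⟩ := hnorm _ hU2 hUfix
  refine ⟨R + S, ?_⟩
  rw [smul_add, ← hR, two_nsmul]
  calc R + R = (R - c • R) + c • R + R := by abel
    _ = (S + c • S) + c • R + R := by rw [hS]
    _ = R + S + (c • R + c • S) := by abel

/-- **The `2`-torsion hypothesis from a transposition.** If `c² = 1`, `#A[2] = 4` and `c` MOVES some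
`T ∈ A[2]`, then `A[2] = {0, T, cT, T + cT}` and its `c`-fixed elements `0`, `T + cT` are norms of
elements of `A[2]`. For `A = E(ℂ)`: `#E[2] = 4`, and complex conjugation moves a `2`-torsion point
iff `E(ℝ)[2] ≠ E[2]` iff `Δ(E) < 0`. [cite: SilvermanAEC2009, Cor. III.6.4(b)] -/
theorem norm_of_smul_eq_of_card_eq_four (hcc : c * c = 1)
    (h4 : Nat.card (AddSubgroup.torsionBy A 2) = 4) {T : A} (hT2 : 2 • T = 0) (hcT : c • T ≠ T)
    (U : A) (hU2 : 2 • U = 0) (hcU : c • U = U) : ∃ S : A, 2 • S = 0 ∧ U = S + c • S := by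
  have key : ∀ x : A, 2 • (c • x) = c • (2 • x) := fun x ↦ by rw [two_nsmul, two_nsmul, smul_add]
  -- the four elements `0, T, cT, T + cT` of `A[2]`
  have hccT : c • c • T = T := by rw [smul_smul, hcc, one_smul]
  have hT0 : T ≠ 0 := fun h ↦ hcT (by rw [h, smul_zero])
  have hcT0 : c • T ≠ 0 := fun h ↦ hT0 (by rw [← hccT, h, smul_zero])
  have hnegT : -T = T := by
    rw [neg_eq_iff_add_eq_zero, ← two_nsmul, hT2]
  have hsum0 : T + c • T ≠ 0 := fun h ↦ hcT ((eq_neg_of_add_eq_zero_right h).trans hnegT)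
  have hsumT : T + c • T ≠ T := fun h ↦ hcT0 (by simpa using h)
  have hsumcT : T + c • T ≠ c • T := fun h ↦ hT0 (by simpa using h)
  have hmem : ∀ x ∈ ({0, T, c • T, T + c • T} : Finset A), x ∈ (AddSubgroup.torsionBy A 2 : Set A) := by
    intro x hx
    simp only [Finset.mem_insert, Finset.mem_singleton] at hx
    change x ∈ AddSubgroup.torsionBy A 2
    rcases hx with rfl | rfl | rfl | rfl
    · exact zero_mem _
    · exact AddSubgroup.torsionBy.nsmul_iff.mpr hT2
    · refine AddSubgroup.torsionBy.nsmul_iff.mpr ?_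
      rw [key, hT2, smul_zero]
    · refine AddSubgroup.torsionBy.nsmul_iff.mpr ?_
      rw [smul_add, key, hT2, smul_zero, add_zero]
  have hcard : ({0, T, c • T, T + c • T} : Finset A).card = 4 := by
    rw [Finset.card_insert_of_notMem, Finset.card_insert_of_notMem, Finset.card_insert_of_notMem,
      Finset.card_singleton]
    · simpa using hsumcT.symm
    · simp only [Finset.mem_insert, Finset.mem_singleton, not_or]
      exact ⟨fun h ↦ hcT h.symm, fun h ↦ hsumT h.symm⟩
    · simp only [Finset.mem_insert, Finset.mem_singleton, not_or]
      exact ⟨hT0.symm, hcT0.symm, hsum0.symm⟩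
  -- `A[2]` is that set
  have hfin : (AddSubgroup.torsionBy A 2 : Set A).Finite := by
    have : Finite (AddSubgroup.torsionBy A 2) := Nat.finite_of_card_ne_zero (by rw [h4]; norm_num)
    exact Set.toFinite _
  have heq : ((({0, T, c • T, T + c • T} : Finset A) : Set A)) = (AddSubgroup.torsionBy A 2 : Set A) :=
    Set.eq_of_subset_of_ncard_le (fun x hx ↦ hmem x (Finset.mem_coe.mp hx))
      (by rw [Set.ncard_coe_finset, hcard, ← h4, ← SetLike.coe_sort_coe, Nat.card_coe_set_eq]) hfin
  have hUmem : U ∈ (({0, T, c • T, T + c • T} : Finset A) : Set A) := by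
    rw [heq]
    exact AddSubgroup.torsionBy.nsmul_iff.mpr hU2
  rw [Finset.mem_coe] at hUmem
  simp only [Finset.mem_insert, Finset.mem_singleton] at hUmem
  rcases hUmem with rfl | rfl | rfl | rfl
  · exact ⟨0, smul_zero _, by rw [smul_zero, add_zero]⟩
  · exact absurd hcU hcT
  · exact absurd (hccT.symm.trans hcU).symm hcT
  · exact ⟨T, hT2, rfl⟩

end Algebra

/-! ## §2 Cohomology: `H¹(G, M) = 0` for `#G ≤ 2` -/

section Cohomology

variable {G : Type u} [Group G] [TopologicalSpace G] [IsTopologicalGroup G] [Finite G]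
  {M : Type u} [AddCommGroup M] [DistribMulAction G M] [TopologicalSpace M] [DiscreteTopology M]

/-- **`H¹(G, M) = 0` for a group of order `≤ 2`** acting on a `2`-divisible discrete module `M`
such that, for the non-trivial `c ∈ G` (if any), every `c`-fixed element of `M[2]` is a norm
`S + cS`, `S ∈ M[2]`: a continuous crossed homomorphism `φ` has `φ(c) + cφ(c) = φ(c²) = 0`, so
`φ(c) = cQ − Q` (§1) and `φ` is the coboundary of `Q`. The tree's
`two_nsmul_continuousCohomology_one_eq_zero_of_natCard_le_two` gives only `2·H¹ = 0`; this is the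
SHARP vanishing. Reading: `H¹(ℝ, E(ℂ)) = 0` when `Δ(E) < 0`.
[cite: SerreGaloisCohomology1997, I §2.4 (the case G = Gal(ℂ/ℝ))]
[cite: SerreLocalFields1979, VIII §4] -/
theorem discreteH1_eq_zero_of_natCard_le_two (hG : Nat.card G ≤ 2)
    (hdiv : ∀ a : M, ∃ b : M, 2 • b = a)
    (hnorm : ∀ c : G, c ≠ 1 → ∀ T : M, 2 • T = 0 → c • T = T → ∃ S : M, 2 • S = 0 ∧ T = S + c • S)
    (x : discreteH1 G M) : x = 0 := by
  obtain ⟨φ, rfl⟩ := oneCocycleClass_surjective _ x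
  rw [oneCocycleClass_eq_zero_iff]
  by_cases h1 : ∃ c : G, c ≠ 1
  · obtain ⟨c, hc⟩ := h1
    have hcc : c * c = 1 := mul_self_eq_one_of_natCard_le_two hG c
    have hP : c • φ.1 c = -φ.1 c := by
      have h := cocycle_mul' φ c c
      rw [hcc, contOneCocycles.apply_one] at h
      exact eq_neg_of_add_eq_zero_right h.symm
    obtain ⟨Q, hQ⟩ := exists_eq_smul_sub_of_smul_eq_neg hcc hdiv (hnorm c hc) hP
    refine ⟨Q, fun σ ↦ ?_⟩
    rw [discreteTopRep_ρ_apply]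
    rcases eq_or_ne σ 1 with rfl | hσ
    · rw [contOneCocycles.apply_one, one_smul, sub_self]
    · rw [eq_of_ne_one_of_natCard_le_two hG hσ hc]
      exact hQ
  · push Not at h1
    refine ⟨0, fun σ ↦ ?_⟩
    rw [h1 σ, contOneCocycles.apply_one, map_zero, sub_zero]

end Cohomology

/-! ## §3 Elliptic curves: `H¹(K_v, E) = 0` at a `K`-field with `#Γ ≤ 2` moving a `2`-torsion point -/

section Elliptic

open WeierstrassCurve

variable {K : Type u} [Field K] (W : WeierstrassCurve K) [W.IsElliptic]
  (E : Type u) [Field E] [Algebra K E] [CharZero E] [Finite (Field.absoluteGaloisGroup E)]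

/-- **`H¹(K_v, E) = 0` when `Γ_{K_v}` has order `≤ 2` and moves some `2`-torsion point.** For an
elliptic curve `W/K` and a `K`-field `E` of characteristic `0` (a completion `K_v`) whose absolute
Galois group has order `≤ 2` (the tree's `natCard_absoluteGaloisGroup_completion_infinitePlace_le_two`
at an infinite place) and MOVES some point of `E(K̄_v)[2]` (at a real place: `E(K_v)[2] ≠ E[2]`,
i.e. `Δ(E) < 0` — the habitat of Q3): every class of `H¹(K_v, E(K̄_v))` (`localH1`) vanishes.
Inputs: `E(K̄_v)` is `2`-divisible (`nsmul_surjective_of_isAlgClosed`), `#E(K̄_v)[2] = 4`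
(`card_torsionBy_eq_sq`), §1–§2. So on `Δ(E) < 0` the archimedean place imposes NO local condition
at `2` — for `E` and for its twists `E^{(c)}` alike (`Δ(E^{(c)}) = c⁶Δ(E) < 0`): the `p = 2`
descent of McCallum §5 to `ℚ` costs nothing at `∞` (g9's `…Descent` §5 reading, now a theorem about
the tree's local condition). [cite: GrossLMS1991, §6 (proof of Prop. 6.2 (1))]
[cite: SerreGaloisCohomology1997, I §2.4] -/
theorem localH1_eq_zero (hG : Nat.card (Field.absoluteGaloisGroup E) ≤ 2)
    (hmove : ∃ (g : Field.absoluteGaloisGroup E) (T : localPoints W E), 2 • T = 0 ∧ g • T ≠ T)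
    (x : W.localH1 E) : x = 0 := by
  obtain ⟨g, T, hT2, hgT⟩ := hmove
  have hg1 : g ≠ 1 := fun h ↦ hgT (by rw [h, one_smul])
  haveI : (W.baseChange (AlgebraicClosure E)).IsElliptic := by rw [baseChange]; infer_instance
  have hdiv : ∀ a : localPoints W E, ∃ b : localPoints W E, 2 • b = a := fun a ↦
    (W.baseChange (AlgebraicClosure E)).nsmul_surjective_of_isAlgClosed (n := 2) two_ne_zero a
  have h4 : Nat.card (AddSubgroup.torsionBy (localPoints W E) 2) = 4 := by
    have h := WeierstrassCurve.card_torsionBy_eq_sq (E := W.baseChange (AlgebraicClosure E))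
      (n := 2) (by norm_num)
    norm_num at h
    exact h
  refine discreteH1_eq_zero_of_natCard_le_two hG hdiv (fun c hc U hU2 hcU ↦ ?_) x
  obtain rfl : c = g := eq_of_ne_one_of_natCard_le_two hG hc hg1
  exact norm_of_smul_eq_of_card_eq_four (mul_self_eq_one_of_natCard_le_two hG c) h4 hT2 hgT U hU2 hcU

/-- **No local condition at such a place**: `localRestrictionKer W K_v = ⊤` — every class of
`H¹(K, E)` dies in `H¹(K_v, E) = 0`. [cite: GrossLMS1991, §6 (proof of Prop. 6.2 (1))] -/
theorem localRestrictionKer_eq_top (hG : Nat.card (Field.absoluteGaloisGroup E) ≤ 2)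
    (hmove : ∃ (g : Field.absoluteGaloisGroup E) (T : localPoints W E), 2 • T = 0 ∧ g • T ≠ T) :
    W.localRestrictionKer E = ⊤ := by
  rw [eq_top_iff]
  intro x _
  rw [localRestrictionKer_eq_ker, AddMonoidHom.mem_ker]
  exact localH1_eq_zero W E hG hmove _

/-- **No `p^∞`-Selmer local condition at such a place**: `selmerLocalKerPrimary W K_v p = ⊤` for every
`p` (the condition is the preimage of the `H¹(·, E)` condition, `selmerLocalKerPrimary_eq_comap`).
The tree's `two_nsmul_mem_selmerLocalKerPrimary_infinitePlace` gives this only up to `2`.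
[cite: GrossLMS1991, §6 (proof of Prop. 6.2 (1))] -/
theorem selmerLocalKerPrimary_eq_top (hG : Nat.card (Field.absoluteGaloisGroup E) ≤ 2)
    (hmove : ∃ (g : Field.absoluteGaloisGroup E) (T : localPoints W E), 2 • T = 0 ∧ g • T ≠ T)
    (p : ℕ) : selmerLocalKerPrimary W E p = ⊤ := by
  rw [selmerLocalKerPrimary_eq_comap, localRestrictionKer_eq_top W E hG hmove, AddSubgroup.comap_top]

end Elliptic

/-! ## §4 Infinite places of a number field -/

section InfinitePlace

open WeierstrassCurve NumberField

variable {K : Type} [Field K] [NumberField K] (W : WeierstrassCurve K) [W.IsElliptic]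
  (w : InfinitePlace K)

/-- **At an infinite place `w` whose decomposition group moves a `2`-torsion point, `H¹(K, E) → H¹(K_w, E)`
is ZERO**: `localRestrictionKer W K_w = ⊤` (no archimedean condition, sharp — not only up to `2`).
For `K = ℚ`, `w = ∞`: the hypothesis says complex conjugation moves a point of `E[2]`, i.e.
`E(ℝ)[2] ≅ ℤ/2`, i.e. `Δ(E) < 0`. [cite: GrossLMS1991, §6 (proof of Prop. 6.2 (1))]
[cite: SerreGaloisCohomology1997, I §2.4] -/
theorem localRestrictionKer_infinitePlace_eq_top
    (hmove : ∃ (g : Field.absoluteGaloisGroup w.Completion) (T : localPoints W w.Completion),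
      2 • T = 0 ∧ g • T ≠ T) :
    W.localRestrictionKer w.Completion = ⊤ := by
  haveI := finite_absoluteGaloisGroup_completion_infinitePlace w
  haveI : CharZero w.Completion :=
    charZero_of_injective_algebraMap (algebraMap K w.Completion).injective
  exact localRestrictionKer_eq_top W w.Completion
    (natCard_absoluteGaloisGroup_completion_infinitePlace_le_two w) hmove

/-- **… and the `p^∞`-Selmer local condition at `w` is vacuous** (`= ⊤`), every `p`.
[cite: GrossLMS1991, §6 (proof of Prop. 6.2 (1))] -/
theorem selmerLocalKerPrimary_infinitePlace_eq_top
    (hmove : ∃ (g : Field.absoluteGaloisGroup w.Completion) (T : localPoints W w.Completion),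
      2 • T = 0 ∧ g • T ≠ T) (p : ℕ) :
    selmerLocalKerPrimary W w.Completion p = ⊤ := by
  haveI := finite_absoluteGaloisGroup_completion_infinitePlace w
  haveI : CharZero w.Completion :=
    charZero_of_injective_algebraMap (algebraMap K w.Completion).injective
  exact selmerLocalKerPrimary_eq_top W w.Completion
    (natCard_absoluteGaloisGroup_completion_infinitePlace_le_two w) hmove p

end InfinitePlace

end Summit.BirchSwinnertonDyer.BirchSwinnertonDyer.Theorems.GenusExact.ArchVanishing

end
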